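import Literature.AnabelianGeometry.EtaleTheta.Discharge.Sec3RatFnMonoidOn
import Literature.AnabelianGeometry.EtaleTheta.Discharge.Sec3Thm37UnitProfinite
import Literature.AnabelianGeometry.SemiGraphs.CosetCategoriesSlimTempered
import Literature.AlgebraicGeometry.Frobenioids.QuasiTemperoidConnectedPart
import HarnessLib

/-!
# [EtTh] Theorem 3.7 (iv) «`D` slim, `Λ ∈ {ℤ, ℝ}` ⟹ `C` slim» at print's GENUINE base `D = B^temp(Π)⁰`:
# the hypothesis «`D` slim» and the structural binder `hFSM` are THEOREMS there (proof-only)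

S. Mochizuki, *The étale theta function and its Frobenioid-theoretic manifestations*, Publ. RIMS **45** (2009)
[MochizukiEtTh2009], Thm. 3.7 (iv), printed p. 306 l. 3 (PDF p. 80), proof p. 306 ll. 14–16: «assertion (iv) follows
from [FrdI] Prop. 1.13 (iii) [since, by assertion (i) …, "condition (b)" of loc. cit. is always satisfied by objects
of `C`]»; Rmk. 3.7.2 (p. 306): «`D₀` is slim [cf. [SemiAnbd], Example 3.10; Remark 3.4.1] and of FSM-, hence also of
FSMFF-, type [cf. [FrdII], Example 1.3, (i)]» [cite: MochizukiEtTh2009, Thm 3.7 p.80].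

abc-iut cell, block C / W6 (seat abc-iut-w6-d048), cone node **EtTh:Thm3.7(iv)** (kernel id `N_EtTh_Thm3_7_iv`).
PROOF-ONLY companion (no definitions, no `Prop` facts, no instances) of abc-iut-L2-t3's statements file
`TemperedFrobenioidProps.lean` (named `Prop` `TemperedFrobenioid.Thm37_iv`).  State of the node before this file
(plan/L2/SUBDAG-EtTh-Thm37.md §C, rows L12–L14/L00): (iv) is PROVED at the canonical [FrdI] vocabulary `treeCatVocab`
for an ARBITRARY base category `D` modulo the binders
* `hBinj` — pull-backs of the Def. 3.6 (i) datum `B₀^Λ` are injective (Def. 3.3 (iii): transition maps of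
  `B₀(Y) = lim Mero(Z_∞)^{Gal}` are inclusions of invariants),
* `hFSM`  — FSM-morphisms of `D` are isomorphisms ([FrdI] Thm. 5.2 preamble «`𝔹` a monoid on `D`», Def. 1.1 (ii) (b)),
* `hdiv`  — `O^×(A)` has no non-trivial divisible element (the only place where «`Λ ∈ {ℤ, ℝ}`» enters; a theorem at
  `Λ = ℝ` over `ofRlfR`, and at `Λ = ℤ` modulo the Prop. 3.4 (ii) isomorphism `hP34`),
plus print's own hypothesis «`D` slim» (`thm37_iv_of_structural`, abc-iut-L1-t1 / abc-iut-L6-t13, `Sec3RatFnMonoidOn`).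

WHAT THIS FILE DISCHARGES.  In every use print makes of Thm. 3.7 the base is the GENUINE one,
`D = D₀ = B^temp(X^log)⁰ ≅ B^temp(Π^tp_X)⁰` (§3 p. 298; Examples 3.9; §5), i.e. the tree's `ConnectedPart (BTemp Π)`
([SemiAnbd] §3 / [FrdI] §0; the full `BTemp Π` carries NO tempered Frobenioid, `TemperedFrobenioid.isEmpty_of_bTemp`).
There both `hFSM` and «`D` slim» are theorems of the tree — [FrdII] Ex. 1.3 (i)
`QuasiTemperoid.BTempConnected.connectedPart_isOfFSMType` and [SemiAnbd] Rmk. 3.4.1 / Ex. 3.10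
`SemiGraphs.isSlim_connectedPart_bTemp` (the two conjuncts of Rmk. 3.7.2; cf. abc-iut-f-138's
`TemperedFrobenioid.remark372_connectedPart_bTemp`, `Sec3Rmk372GenuineBase`, not imported here) — so:
* §1 (any `D` of FSM-type, e.g. any `D` satisfying Rmk. 3.7.2): `hBmon`, «`C` is a Frobenioid», `Thm37_iv` and the
  CONCLUSION `IsSlim C` from {`hBinj`, `hdiv`} (+ `Remark372 D`);
* §2 (genuine base `ConnectedPart (BTemp Π)`, `Π` tempered and temp-slim, resp. `Π = Π^tp_X` for abc-iut-L3's
  `TemperedArithmeticGroup`): the CONCLUSION «`C` is slim» modulo {`hBinj`, `hdiv`} only;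
* §3 (`Λ = ℝ`, constructed data `ofRlfR`): «`C` is slim» modulo `hBinj` ALONE;
* §4 (`Λ = ℤ`, constructed data `ofRlfZ`): «`C` is slim» modulo {`hBinj`, `hP34`}.
Binder census of the node at the genuine base: {`hBmon` = `hBinj`+`hFSM`, «`D` slim», `hdiv`} ↦ {`hBinj`} (`Λ = ℝ`) /
{`hBinj`, `hP34`} (`Λ = ℤ`); `hBinj`, `hP34` are properties of the Def. 3.3 (iii) data, dischargeable only by their
geometric instantiation (campaign-L side).  HONEST FRAMING: refereed pre-IUT material ([SemiAnbd] 2006, [FrdI]/[FrdII]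
2008, [EtTh] 2009); every theorem below is an implication for data so parametrised; nothing here bears on
[IUTchIII] Cor. 3.12; typed ≠ proved — here PROVED modulo the literal binders.
-/

namespace Literature.AnabelianGeometry.EtaleTheta

open CategoryTheory Opposite Function Literature.AlgebraicGeometry.Frobenioids Literature.AnabelianGeometry.SemiGraphs

namespace TemperedFrobenioid

universe u₀ v₀ u v w uK

/-! ### §1 Any base category of FSM-type -/

section FSMType

variable {D₀ : Type u₀} [Category.{v₀} D₀] {V : FrdIMonoidStub.{w}}
  {T : RealifiedDivisorMonoids (D₀ := D₀) V} {D : Type u} [Category.{v} D]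
  {IsRational IsStrictlyRational : (Dᵒᵖ ⥤ CommMonCat.{w}) → Prop}
  (C₀ : TemperedFrobenioid T D (treeCatVocab D IsRational IsStrictlyRational)) {p : ℕ} [Fact p.Prime]

/-- **`hBmon` from `hBinj` over a base of FSM-type**: `B = B₀^Λ|_D ×_{(Φ^{ℝ-log})^gp} Φ^gp` is a monoid on `D`
([FrdI] Def. 1.1 (ii)) as soon as the pull-backs of `B₀^Λ` are injective, when `D` is of FSM-type.
[cite: MochizukiEtTh2009, Def 3.6 p.77] -/
theorem isMonoidOn_ratFnFunctor_of_isOfFSMType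
    (hBinj : ∀ {Y Y' : D₀ᵒᵖ} (g : Y ⟶ Y'), Injective (T.BΛ.map g).hom) (hD : IsOfFSMType D) :
    IsMonoidOn C₀.ratFnFunctor :=
  C₀.isMonoidOn_ratFnFunctor hBinj fun α hα => hD.isIso_of_isFSM α hα

/-- **The tempered Frobenioid over a base of FSM-type IS a Frobenioid** ([FrdI] Def. 1.3 via Thm. 5.2 (ii)),
modulo `hBinj` only. [cite: MochizukiEtTh2009, Def 3.6 p.77] -/
theorem isFrobenioid_of_isOfFSMType
    (hBinj : ∀ {Y Y' : D₀ᵒᵖ} (g : Y ⟶ Y'), Injective (T.BΛ.map g).hom) (hD : IsOfFSMType D) :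
    PreFrobenioid.IsFrobenioid C₀.toElem :=
  C₀.isFrobenioid_of_structural hBinj fun α hα => hD.isIso_of_isFSM α hα

/-- **Thm. 3.7 (iv)** (named `Prop` `Thm37_iv`) over a base of FSM-type, modulo `hBinj` and `hdiv`.
[cite: MochizukiEtTh2009, Thm 3.7 p.80] -/
theorem thm37_iv_of_isOfFSMType
    (hBinj : ∀ {Y Y' : D₀ᵒᵖ} (g : Y ⟶ Y'), Injective (T.BΛ.map g).hom) (hD : IsOfFSMType D)
    (hdiv : ∀ (X : C₀.category) (α : Aut X), α ∈ PreFrobenioid.unitsSubgroup C₀.toElem X →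
      (∀ n : ℕ+, ∃ β : Aut X, β ∈ PreFrobenioid.unitsSubgroup C₀.toElem X ∧ β ^ (n : ℕ) = α) → α = 1) :
    C₀.Thm37_iv :=
  C₀.thm37_iv_of_structural hBinj (fun α hα => hD.isIso_of_isFSM α hα) hdiv

/-- **The CONCLUSION of Thm. 3.7 (iv), «`C` is slim», over a base satisfying Rmk. 3.7.2** (`D` slim and of
FSM-type), modulo `hBinj` and `hdiv`. [cite: MochizukiEtTh2009, Thm 3.7 p.80] -/
theorem isSlim_category_of_remark372 (h372 : Remark372 D)
    (hBinj : ∀ {Y Y' : D₀ᵒᵖ} (g : Y ⟶ Y'), Injective (T.BΛ.map g).hom)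
    (hdiv : ∀ (X : C₀.category) (α : Aut X), α ∈ PreFrobenioid.unitsSubgroup C₀.toElem X →
      (∀ n : ℕ+, ∃ β : Aut X, β ∈ PreFrobenioid.unitsSubgroup C₀.toElem X ∧ β ^ (n : ℕ) = α) → α = 1) :
    IsSlim C₀.category :=
  C₀.isSlim_category_of_isFrobenioid (C₀.isFrobenioid_of_isOfFSMType hBinj h372.2.1) hdiv h372.1

/-- **«`C` is slim» over a base satisfying Rmk. 3.7.2, case `Λ = ℤ` of print's proof**: `hdiv` from the Prop. 3.4 (ii)
isomorphisms `Ker(B₀^Λ(Y_A)^× → (Φ₀^ℝ)^gp(Y_A)) ≅ O_L^×` (`hP34`, BY NAME; `O_L^×` profinite, [FrdII] Thm. 1.2 (i)).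
[cite: MochizukiEtTh2009, Thm 3.7 p.80] -/
theorem isSlim_category_of_remark372_of_kerIsoPadicUnits (h372 : Remark372 D)
    (hBinj : ∀ {Y Y' : D₀ᵒᵖ} (g : Y ⟶ Y'), Injective (T.BΛ.map g).hom)
    (hP34 : ∀ A : Dᵒᵖ, ∃ L : PadicFrd.PadicFld.{uK} p, L.IsPadicLocal ∧
      Nonempty (((T.divΛ (C₀.baseOp A)).comp (Units.coeHom (T.BΛ.obj (C₀.baseOp A)))).ker ≃*
        PadicFrd.unitSubgroup L.K)) :
    IsSlim C₀.category :=
  C₀.isSlim_category_of_kerIsoPadicUnits (C₀.isFrobenioid_of_isOfFSMType hBinj h372.2.1) hP34 h372.1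

/-- **«`C` is slim» over a base satisfying Rmk. 3.7.2, case `Λ = ℝ` of print's proof**: `hdiv` because `C` is of
unit-trivial type when `B₀^Λ → (Φ₀^ℝ)^gp` is injective (`hinj`; Def. 3.6 (i) `B₀^ℝ ⊆ (Φ₀^ℝ)^gp`).
[cite: MochizukiEtTh2009, Thm 3.7 p.80] -/
theorem isSlim_category_of_remark372_of_divΛ_injective (h372 : Remark372 D)
    (hBinj : ∀ {Y Y' : D₀ᵒᵖ} (g : Y ⟶ Y'), Injective (T.BΛ.map g).hom)
    (hinj : ∀ A : Dᵒᵖ, Injective (T.divΛ (C₀.baseOp A))) : IsSlim C₀.category :=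
  C₀.isSlim_category_of_divΛ_injective (C₀.isFrobenioid_of_isOfFSMType hBinj h372.2.1) hinj h372.1

end FSMType

/-! ### §2 The genuine base `D = B^temp(Π)⁰ = ConnectedPart (BTemp Π)` -/

section ConnectedTemperoid

variable {G : Type u} [Group G] [TopologicalSpace G] {D₀ : Type u₀} [Category.{v₀} D₀] {V : FrdIMonoidStub.{w}}
  {T : RealifiedDivisorMonoids (D₀ := D₀) V}
  {IsRational IsStrictlyRational : ((ConnectedPart (BTemp G))ᵒᵖ ⥤ CommMonCat.{w}) → Prop}
  (C₀ : TemperedFrobenioid T (ConnectedPart (BTemp G))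
    (treeCatVocab (ConnectedPart (BTemp G)) IsRational IsStrictlyRational))

/-- **`hBmon` from `hBinj` ALONE at the genuine base `B^temp(Π)⁰`** (any topological group `Π`): the FSM clause is
[FrdII] Ex. 1.3 (i) «every monomorphism of `E⁰` is an isomorphism». [cite: MochizukiEtTh2009, Def 3.6 p.77] -/
theorem isMonoidOn_ratFnFunctor_connectedPart_bTemp
    (hBinj : ∀ {Y Y' : D₀ᵒᵖ} (g : Y ⟶ Y'), Injective (T.BΛ.map g).hom) : IsMonoidOn C₀.ratFnFunctor :=
  C₀.isMonoidOn_ratFnFunctor_of_isOfFSMType hBinj QuasiTemperoid.BTempConnected.connectedPart_isOfFSMType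

/-- **A tempered Frobenioid over the genuine base `B^temp(Π)⁰` IS a Frobenioid**, modulo `hBinj` alone.
[cite: MochizukiEtTh2009, Def 3.6 p.77] -/
theorem isFrobenioid_connectedPart_bTemp
    (hBinj : ∀ {Y Y' : D₀ᵒᵖ} (g : Y ⟶ Y'), Injective (T.BΛ.map g).hom) :
    PreFrobenioid.IsFrobenioid C₀.toElem :=
  C₀.isFrobenioid_of_isOfFSMType hBinj QuasiTemperoid.BTempConnected.connectedPart_isOfFSMType

/-- **Thm. 3.7 (iv)** (named `Prop`) at the genuine base `B^temp(Π)⁰`, modulo `hBinj` and `hdiv`.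
[cite: MochizukiEtTh2009, Thm 3.7 p.80] -/
theorem thm37_iv_connectedPart_bTemp
    (hBinj : ∀ {Y Y' : D₀ᵒᵖ} (g : Y ⟶ Y'), Injective (T.BΛ.map g).hom)
    (hdiv : ∀ (X : C₀.category) (α : Aut X), α ∈ PreFrobenioid.unitsSubgroup C₀.toElem X →
      (∀ n : ℕ+, ∃ β : Aut X, β ∈ PreFrobenioid.unitsSubgroup C₀.toElem X ∧ β ^ (n : ℕ) = α) → α = 1) :
    C₀.Thm37_iv :=
  C₀.thm37_iv_of_isOfFSMType hBinj QuasiTemperoid.BTempConnected.connectedPart_isOfFSMType hdiv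

variable [IsTopologicalGroup G] {p : ℕ} [Fact p.Prime]

/-- **The CONCLUSION of Thm. 3.7 (iv) at the genuine base `B^temp(Π)⁰` of a tempered, temp-slim group `Π`**:
«`C` is slim», print's hypothesis «`D` slim» being [SemiAnbd] Rmk. 3.4.1 / Ex. 3.10 (`isSlim_connectedPart_bTemp`);
modulo `hBinj` and `hdiv`. [cite: MochizukiEtTh2009, Thm 3.7 p.80] -/
theorem isSlim_category_connectedPart_bTemp (hG : IsTempered G) (hZ : IsSlimGroup G)
    (hBinj : ∀ {Y Y' : D₀ᵒᵖ} (g : Y ⟶ Y'), Injective (T.BΛ.map g).hom)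
    (hdiv : ∀ (X : C₀.category) (α : Aut X), α ∈ PreFrobenioid.unitsSubgroup C₀.toElem X →
      (∀ n : ℕ+, ∃ β : Aut X, β ∈ PreFrobenioid.unitsSubgroup C₀.toElem X ∧ β ^ (n : ℕ) = α) → α = 1) :
    IsSlim C₀.category :=
  C₀.isSlim_category_of_isFrobenioid (C₀.isFrobenioid_connectedPart_bTemp hBinj) hdiv
    (isSlim_connectedPart_bTemp hG hZ)

/-- Same, **case `Λ = ℤ` of print's proof**: «`C` is slim» at the genuine base `B^temp(Π)⁰` modulo `hBinj` and the
Prop. 3.4 (ii) isomorphisms `hP34` only. [cite: MochizukiEtTh2009, Thm 3.7 p.80] -/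
theorem isSlim_category_connectedPart_bTemp_of_kerIsoPadicUnits (hG : IsTempered G) (hZ : IsSlimGroup G)
    (hBinj : ∀ {Y Y' : D₀ᵒᵖ} (g : Y ⟶ Y'), Injective (T.BΛ.map g).hom)
    (hP34 : ∀ A : (ConnectedPart (BTemp G))ᵒᵖ, ∃ L : PadicFrd.PadicFld.{uK} p, L.IsPadicLocal ∧
      Nonempty (((T.divΛ (C₀.baseOp A)).comp (Units.coeHom (T.BΛ.obj (C₀.baseOp A)))).ker ≃*
        PadicFrd.unitSubgroup L.K)) :
    IsSlim C₀.category :=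
  C₀.isSlim_category_of_kerIsoPadicUnits (C₀.isFrobenioid_connectedPart_bTemp hBinj) hP34
    (isSlim_connectedPart_bTemp hG hZ)

/-- Same, **case `Λ = ℝ` of print's proof**: «`C` is slim» at the genuine base `B^temp(Π)⁰` modulo `hBinj` and the
injectivity `hinj` of `B₀^Λ → (Φ₀^ℝ)^gp` only. [cite: MochizukiEtTh2009, Thm 3.7 p.80] -/
theorem isSlim_category_connectedPart_bTemp_of_divΛ_injective (hG : IsTempered G) (hZ : IsSlimGroup G)
    (hBinj : ∀ {Y Y' : D₀ᵒᵖ} (g : Y ⟶ Y'), Injective (T.BΛ.map g).hom)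
    (hinj : ∀ A : (ConnectedPart (BTemp G))ᵒᵖ, Injective (T.divΛ (C₀.baseOp A))) : IsSlim C₀.category :=
  C₀.isSlim_category_of_divΛ_injective (C₀.isFrobenioid_connectedPart_bTemp hBinj) hinj
    (isSlim_connectedPart_bTemp hG hZ)

end ConnectedTemperoid

/-! ### §2′ The base of [EtTh] §3–§5 as printed: `D₀ = B^temp(Π^tp_X)⁰` for a tempered arithmetic fundamental group -/

section TemperedArithmeticGroup

variable {K : Type u} [Field K] (X : TemperedArithmeticGroup.{u} K) {D₀ : Type u₀} [Category.{v₀} D₀]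
  {V : FrdIMonoidStub.{w}} {T : RealifiedDivisorMonoids (D₀ := D₀) V}
  {IsRational IsStrictlyRational : ((ConnectedPart (BTemp X.Pi))ᵒᵖ ⥤ CommMonCat.{w}) → Prop}
  (C₀ : TemperedFrobenioid T (ConnectedPart (BTemp X.Pi))
    (treeCatVocab (ConnectedPart (BTemp X.Pi)) IsRational IsStrictlyRational)) {p : ℕ} [Fact p.Prime]

/-- **Thm. 3.7 (iv) as printed, conclusion «`C` is slim», at `D = B^temp(Π^tp_X)⁰`** (`Π^tp_X` tempered and temp-slim,
[SemiAnbd] Ex. 3.10): modulo `hBinj` and `hdiv` only. [cite: MochizukiEtTh2009, Thm 3.7 p.80] -/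
theorem isSlim_category_of_temperedArithmeticGroup
    (hBinj : ∀ {Y Y' : D₀ᵒᵖ} (g : Y ⟶ Y'), Injective (T.BΛ.map g).hom)
    (hdiv : ∀ (X : C₀.category) (α : Aut X), α ∈ PreFrobenioid.unitsSubgroup C₀.toElem X →
      (∀ n : ℕ+, ∃ β : Aut X, β ∈ PreFrobenioid.unitsSubgroup C₀.toElem X ∧ β ^ (n : ℕ) = α) → α = 1) :
    IsSlim C₀.category :=
  C₀.isSlim_category_of_isFrobenioid (C₀.isFrobenioid_connectedPart_bTemp hBinj) hdiv X.isSlim_connectedPart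

/-- Same, **case `Λ = ℤ` of print's proof**: «`C` is slim» at `D = B^temp(Π^tp_X)⁰` modulo `hBinj` and the Prop. 3.4 (ii)
isomorphisms `hP34` only. [cite: MochizukiEtTh2009, Thm 3.7 p.80] -/
theorem isSlim_category_of_temperedArithmeticGroup_of_kerIsoPadicUnits
    (hBinj : ∀ {Y Y' : D₀ᵒᵖ} (g : Y ⟶ Y'), Injective (T.BΛ.map g).hom)
    (hP34 : ∀ A : (ConnectedPart (BTemp X.Pi))ᵒᵖ, ∃ L : PadicFrd.PadicFld.{uK} p, L.IsPadicLocal ∧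
      Nonempty (((T.divΛ (C₀.baseOp A)).comp (Units.coeHom (T.BΛ.obj (C₀.baseOp A)))).ker ≃*
        PadicFrd.unitSubgroup L.K)) :
    IsSlim C₀.category :=
  C₀.isSlim_category_of_kerIsoPadicUnits (C₀.isFrobenioid_connectedPart_bTemp hBinj) hP34 X.isSlim_connectedPart

end TemperedArithmeticGroup

/-! ### §3 `Λ = ℝ`: the constructed data `ofRlfR dm hpf` over the genuine base — «`C` slim» modulo `hBinj` ALONE -/

section OfRlfR

variable {G : Type u} [Group G] [TopologicalSpace G] [IsTopologicalGroup G] {D₀ : Type u₀} [Category.{v₀} D₀]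
  (dm : DivisorMonoids.{u₀, v₀, w} D₀) (hpf : ∀ Y : D₀ᵒᵖ, IsPerfFactorial (dm.Φ₀.obj Y))
  {IsRational IsStrictlyRational : ((ConnectedPart (BTemp G))ᵒᵖ ⥤ CommMonCat.{w}) → Prop}
  (C₀ : TemperedFrobenioid (RealifiedDivisorMonoids.ofRlfR dm hpf) (ConnectedPart (BTemp G))
    (treeCatVocab (ConnectedPart (BTemp G)) IsRational IsStrictlyRational))

/-- **Thm. 3.7 (iv) for monoid type `ℝ` at the genuine base, conclusion «`C` is slim», modulo `hBinj` ALONE**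
(`Π` tempered and temp-slim): `hdiv` ⟸ unit-trivial type (`thm37_iv_ofRlfR_treeCatVocab`), `hFSM` ⟸ [FrdII] Ex. 1.3 (i),
«`D` slim» ⟸ [SemiAnbd] Rmk. 3.4.1. [cite: MochizukiEtTh2009, Thm 3.7 p.80] -/
theorem isSlim_category_ofRlfR_connectedPart_bTemp (hG : IsTempered G) (hZ : IsSlimGroup G)
    (hBinj : ∀ {Y Y' : D₀ᵒᵖ} (g : Y ⟶ Y'), Injective ((RealifiedDivisorMonoids.ofRlfR dm hpf).BΛ.map g).hom) :
    IsSlim C₀.category :=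
  C₀.thm37_iv_ofRlfR_treeCatVocab dm hpf (C₀.isMonoidOn_ratFnFunctor_connectedPart_bTemp hBinj)
    (isSlim_connectedPart_bTemp hG hZ) (Or.inr (C₀.monoidType_ofRlfR dm hpf))

end OfRlfR

/-! ### §4 `Λ = ℤ`: the constructed data `ofRlfZ dm hpf` over the genuine base — «`C` slim» modulo `hBinj` + `hP34` -/

section OfRlfZ

variable {G : Type u} [Group G] [TopologicalSpace G] [IsTopologicalGroup G] {D₀ : Type u₀} [Category.{v₀} D₀]
  (dm : DivisorMonoids.{u₀, v₀, w} D₀) (hpf : ∀ Y : D₀ᵒᵖ, IsPerfFactorial (dm.Φ₀.obj Y))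
  {IsRational IsStrictlyRational : ((ConnectedPart (BTemp G))ᵒᵖ ⥤ CommMonCat.{w}) → Prop}
  (C₁ : TemperedFrobenioid (RealifiedDivisorMonoids.ofRlfZ dm hpf) (ConnectedPart (BTemp G))
    (treeCatVocab (ConnectedPart (BTemp G)) IsRational IsStrictlyRational)) {p : ℕ} [Fact p.Prime]

/-- **Thm. 3.7 (i) «unit-profinite type» ∧ (iv) «`C` slim» for monoid type `ℤ` at the genuine base**, modulo `hBinj`
and the Prop. 3.4 (ii) isomorphisms `hP34` only (`Π` tempered and temp-slim). [cite: MochizukiEtTh2009, Thm 3.7 p.80] -/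
theorem isOfUnitProfiniteType_and_isSlim_ofRlfZ_connectedPart_bTemp (hG : IsTempered G) (hZ : IsSlimGroup G)
    (hBinj : ∀ {Y Y' : D₀ᵒᵖ} (g : Y ⟶ Y'), Injective ((RealifiedDivisorMonoids.ofRlfZ dm hpf).BΛ.map g).hom)
    (hP34 : ∀ A : (ConnectedPart (BTemp G))ᵒᵖ, ∃ L : PadicFrd.PadicFld.{uK} p, L.IsPadicLocal ∧
      Nonempty ((((RealifiedDivisorMonoids.ofRlfZ dm hpf).divΛ (C₁.baseOp A)).comp
        (Units.coeHom ((RealifiedDivisorMonoids.ofRlfZ dm hpf).BΛ.obj (C₁.baseOp A)))).ker ≃*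
        PadicFrd.unitSubgroup L.K)) :
    PreFrobenioid.IsOfUnitProfiniteType C₁.toElem ∧ IsSlim C₁.category :=
  have hF := C₁.isFrobenioid_connectedPart_bTemp hBinj
  ⟨C₁.isOfUnitProfiniteType_of_kerIsoPadicUnits hF hP34,
    C₁.isSlim_category_of_kerIsoPadicUnits hF hP34 (isSlim_connectedPart_bTemp hG hZ)⟩

end OfRlfZ

end TemperedFrobenioid

end Literature.AnabelianGeometry.EtaleTheta
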